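import Summits.RiemannHypothesis.RiemannHypothesis.Theorems.WeilTwoPrimeDeflE25ODef
import Summits.RiemannHypothesis.RiemannHypothesis.Theorems.WeilTwoPrimeDeflE25ODataPO29
import Literature.NumberTheory.LFunctions.WeilBlockRowsR
import HarnessLib

/-!
# Deflated two-prime certificate E25O: the materialized odd block agrees with `P_r + Σ μ ĉ ĉᵀ`, rows 0–9

`WeilCert.checkPmRowG` for certificate E25O (odd block), by `decide +kernel`. Pure proof file; nothing is asserted.
-/

set_option linter.dupNamespace false

noncomputable section

namespace Summit.RiemannHypothesis.RiemannHypothesis.Theorems.EvenWinsBeyondArch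

open Literature.NumberTheory.LFunctions

set_option maxHeartbeats 0 in
/-- Row 0 of the materialized odd block is row 0 of `P_r + Σ μ ĉ ĉᵀ` (certificate E25O). [folklore] -/
theorem checkPmRowG1_0_weilCertDeflE25O : weilCertDeflE25OBase.checkPmRowG weilCertDeflE25OP weilCertDeflE25OPmO 1 0 = true := by
  decide +kernel

set_option maxHeartbeats 0 in
/-- Row 1 of the materialized odd block is row 1 of `P_r + Σ μ ĉ ĉᵀ` (certificate E25O). [folklore] -/
theorem checkPmRowG1_1_weilCertDeflE25O : weilCertDeflE25OBase.checkPmRowG weilCertDeflE25OP weilCertDeflE25OPmO 1 1 = true := by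
  decide +kernel

set_option maxHeartbeats 0 in
/-- Row 2 of the materialized odd block is row 2 of `P_r + Σ μ ĉ ĉᵀ` (certificate E25O). [folklore] -/
theorem checkPmRowG1_2_weilCertDeflE25O : weilCertDeflE25OBase.checkPmRowG weilCertDeflE25OP weilCertDeflE25OPmO 1 2 = true := by
  decide +kernel

set_option maxHeartbeats 0 in
/-- Row 3 of the materialized odd block is row 3 of `P_r + Σ μ ĉ ĉᵀ` (certificate E25O). [folklore] -/
theorem checkPmRowG1_3_weilCertDeflE25O : weilCertDeflE25OBase.checkPmRowG weilCertDeflE25OP weilCertDeflE25OPmO 1 3 = true := by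
  decide +kernel

set_option maxHeartbeats 0 in
/-- Row 4 of the materialized odd block is row 4 of `P_r + Σ μ ĉ ĉᵀ` (certificate E25O). [folklore] -/
theorem checkPmRowG1_4_weilCertDeflE25O : weilCertDeflE25OBase.checkPmRowG weilCertDeflE25OP weilCertDeflE25OPmO 1 4 = true := by
  decide +kernel

set_option maxHeartbeats 0 in
/-- Row 5 of the materialized odd block is row 5 of `P_r + Σ μ ĉ ĉᵀ` (certificate E25O). [folklore] -/
theorem checkPmRowG1_5_weilCertDeflE25O : weilCertDeflE25OBase.checkPmRowG weilCertDeflE25OP weilCertDeflE25OPmO 1 5 = true := by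
  decide +kernel

set_option maxHeartbeats 0 in
/-- Row 6 of the materialized odd block is row 6 of `P_r + Σ μ ĉ ĉᵀ` (certificate E25O). [folklore] -/
theorem checkPmRowG1_6_weilCertDeflE25O : weilCertDeflE25OBase.checkPmRowG weilCertDeflE25OP weilCertDeflE25OPmO 1 6 = true := by
  decide +kernel

set_option maxHeartbeats 0 in
/-- Row 7 of the materialized odd block is row 7 of `P_r + Σ μ ĉ ĉᵀ` (certificate E25O). [folklore] -/
theorem checkPmRowG1_7_weilCertDeflE25O : weilCertDeflE25OBase.checkPmRowG weilCertDeflE25OP weilCertDeflE25OPmO 1 7 = true := by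
  decide +kernel

set_option maxHeartbeats 0 in
/-- Row 8 of the materialized odd block is row 8 of `P_r + Σ μ ĉ ĉᵀ` (certificate E25O). [folklore] -/
theorem checkPmRowG1_8_weilCertDeflE25O : weilCertDeflE25OBase.checkPmRowG weilCertDeflE25OP weilCertDeflE25OPmO 1 8 = true := by
  decide +kernel

set_option maxHeartbeats 0 in
/-- Row 9 of the materialized odd block is row 9 of `P_r + Σ μ ĉ ĉᵀ` (certificate E25O). [folklore] -/
theorem checkPmRowG1_9_weilCertDeflE25O : weilCertDeflE25OBase.checkPmRowG weilCertDeflE25OP weilCertDeflE25OPmO 1 9 = true := by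
  decide +kernel


end Summit.RiemannHypothesis.RiemannHypothesis.Theorems.EvenWinsBeyondArch
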